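import Literature.NumberTheory.Transcendental.ThetaSubgroupClassificationGeneral
import Literature.NumberTheory.Transcendental.PkappaHardData
import HarnessLib

/-!
# Philippon's zero estimate on `M_κ = 𝔾ₘ^β × P_κ`: discharge of `philippon1986_std`

Topic: `Literature/NumberTheory/Transcendental`. The named fact
`Literature.NumberTheory.Transcendental.philippon1986_std` (P. Philippon, *Lemmes de zéros dans
les groupes algébriques commutatifs*, Bull. Soc. Math. France 114 (1986), Thm. 2.1, in the standard
uniformisation of `M_κ`, lattices without complex multiplication) is PROVED:

* `GaGmE.Std.classification_thetaModel₀_notCM` — the classification of the `Θ`-closed irreducible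
  subgroups of `Lie M_κ,ℂ` in the unconditional theta model `thetaModel₀`
  (`ThetaSubgroupClassificationGeneral.classification_notCM`);
* `philippon1986_std_holds : philippon1986_std` — by `GaGmE.Std.philippon_of_classification`
  (Roy's zero estimate for analytic group models, `AnalyticGroupModel.zero_estimate`, on the theta
  model with the hard data of `PkappaHardData`, and the classification).

The architecture follows D. Roy's proof of Philippon's theorem (LNM 1752, Ch. 11, Thm. 4.1):
abstract zero estimate for an analytic group model (`ZeroEst*.lean`), the theta model of `M_κ`
(`Pkappa*.lean`), and the identification of the obstruction subgroups `H₀ = Lie G' + ker exp`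
(`ThetaSubgroup*.lean`, `ThetaMorphic`, `ThetaTransvection`, `EllipticKronecker`,
`ThetaLinealityStructure`, `ThetaFibreCount`, `ThetaSubgroupClassificationGeneral`).

## References

* P. Philippon, *Lemmes de zéros dans les groupes algébriques commutatifs*, Bull. Soc. Math.
  France 114 (1986), 355–383, Thm. 2.1. [Philippon1986]
* Yu. V. Nesterenko, P. Philippon (eds.), *Introduction to Algebraic Independence Theory*,
  LNM 1752, Springer 2001, Ch. 11 (D. Roy), Thm. 4.1. [NesterenkoPhilippon2001]
-/

noncomputable section

open Complex MvPolynomial Module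
open scoped PeriodPair

namespace Literature.NumberTheory.Transcendental

namespace GaGmE

namespace Std

variable {β γ δ : Type} [Fintype β] [Fintype γ] [Fintype δ] [DecidableEq β] [DecidableEq γ] [DecidableEq δ]
variable (L : PeriodPair) (κM : δ → γ → Kbar)

/-- **Classification of the obstruction subgroups in the unconditional theta model `thetaModel₀`
of `M_κ`, no complex multiplication** — the hypothesis `hCL` of `philippon_of_classification`.
[cite: NesterenkoPhilippon2001, Ch. 11 Thm. 4.1] -/
theorem classification_thetaModel₀_notCM (hCM : ¬ L.HasCM) (H₀ : AddSubgroup (β ⊕ (γ ⊕ δ) → ℂ))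
    (hH₀ : (thetaModel₀ (β := β) L κM).IsIrred (H₀ : Set (β ⊕ (γ ⊕ δ) → ℂ))) :
    ∃ K : SubgroupDataC β γ δ κM, (preimageSubgroup L κM K : Set (β ⊕ (γ ⊕ δ) → ℂ)) = H₀ ∧
      AnalyticGroupModel.linSpace (↑H₀ : Set (β ⊕ (γ ⊕ δ) → ℂ)) = K.tangent ∧
      finrank ℂ K.tangent + 1 ≤ (thetaModel₀ (β := β) L κM).coneDim (↑H₀ : Set (β ⊕ (γ ⊕ δ) → ℂ)) :=
  classification_notCM L κM (thetaModel₀ (β := β) L κM) (idxEquiv β γ δ).symm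
    (Θ_thetaModel_symm L κM (hardData L κM)) hCM H₀ hH₀

end Std

end GaGmE

/-- **Philippon's zero estimate on `M_κ` (1986, Thm. 2.1), standard uniformisation, no complex
multiplication: the named fact `philippon1986_std` holds.** [cite: Philippon1986, Thm. 2.1]
[cite: NesterenkoPhilippon2001, Ch. 11 Thm. 4.1] -/
theorem philippon1986_std_holds : philippon1986_std := by
  intro L _ _ hCM β γ δ _ _ _ _ κM
  classical
  exact GaGmE.Std.philippon_of_classification L κM (GaGmE.Std.classification_thetaModel₀_notCM L κM hCM)

end Literature.NumberTheory.Transcendental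

end
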